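import Literature.MathematicalPhysics.QuantumFieldTheory.PeriodicBoxRotation
import HarnessLib

/-!
# Inclusion of periodic boxes: rooted small clusters do not see the size of the box

Sequel of `PeriodicBoxRotation` (uses `PlaqSystemLocalIso`). For sizes `n ≤ n'` agreeing outside a
set of directions `J`, the inclusion `BoxLabel.castLE` of the labels of the box of sizes `n` into
those of the box of sizes `n'` (same fundamental-domain coordinates) is a local isomorphism of the
box plaquette systems on the labels whose coordinates in the directions of `J` are `< m`, provided
`m + 1 ≤ nᵢ` for `i ∈ J` (no bond of such a label wraps around a direction in which the sizes
differ: `BoxLabel.bonds_castLE`, `BoxLabel.cost_castLE`). Consequently the families of polymers of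
total size `< m` rooted in every direction of `J`, together with their truncated functionals, are the
same for both boxes (`sum_small_boxRooted_eq_of_le`): the rooted small-cluster part of `log Z` is
independent of the sizes in the directions of `J` (tubes `L³ × t` of different lengths, `J = {3}`;
tori `P⁴` of different sides, `J = univ`). Everything is proved; no named facts; no new definitions.

## References

* E. Seiler, LNP 159 (1982), Ch. 2–3. [SeilerLNP1982]
* R. Kotecký, D. Preiss, Comm. Math. Phys. 103 (1986) 491–498, §2. [KoteckyPreiss1986]
-/

noncomputable section
namespace Literature.MathematicalPhysics.QuantumFieldTheory

open MeasureTheory Finset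
open Literature.Probability.LatticeModels

variable {d : ℕ} {n n' : Fin d → ℕ}

/-! ### The inclusion of a box into a larger box on non-wrapping labels -/

namespace BoxSite

/-- The value of a cast coordinate. [folklore] -/
@[simp] theorem castLE_apply_val (h : ∀ i, n i ≤ n' i) (x : BoxSite n) (i : Fin d) :
    ((castLE h x i : Fin (n' i)) : ℕ) = (x i : ℕ) := rfl

/-- **The inclusion intertwines the shifts where nothing wraps differently**: in a direction `μ`
in which either the coordinate stays below `n μ - 1` or the two sizes agree. [folklore] -/
theorem castLE_shift (h : ∀ i, n i ≤ n' i) {μ : Fin d} {x : BoxSite n}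
    (hμ : (x μ : ℕ) + 1 < n μ ∨ n μ = n' μ) : castLE h (shift μ x) = shift μ (castLE h x) := by
  funext j
  by_cases hj : j = μ
  · subst hj
    apply Fin.ext
    have hn : 0 < n j := Fin.pos (x j)
    have hn' : 0 < n' j := lt_of_lt_of_le hn (h j)
    simp only [shift, castLE, Function.update_self, Fin.val_castLE,
      Literature.GroupTheory.CombinatorialGroupTheory.val_finRotate hn,
      Literature.GroupTheory.CombinatorialGroupTheory.val_finRotate hn']
    rcases hμ with hμ | hμ
    · rw [Nat.mod_eq_of_lt hμ, Nat.mod_eq_of_lt (lt_of_lt_of_le hμ (h j))]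
    · exact congrArg (fun k => ((x j : ℕ) + 1) % k) hμ
  · simp only [shift, castLE, Function.update_of_ne hj]

end BoxSite

namespace BoxLabel

/-- A label is `J`-small at scale `m`: its coordinates in the directions of `J` are `< m`.
(Inline predicate; the labels of a family rooted in the directions of `J` are `J`-small.)
[folklore] -/
theorem coord_lt_of_boxRooted {J : Finset (Fin d)} {m : ℕ} {𝒞 : Finset (Finset (BoxLabel n))}
    (h : ∀ j ∈ J, BoxRooted j m 𝒞) {Y : Finset (BoxLabel n)} (hY : Y ∈ 𝒞) {p : BoxLabel n} (hp : p ∈ Y)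
    {j : Fin d} (hj : j ∈ J) : coord j p < m :=
  (h j hj).1 Y hY p hp

/-- **The bonds of a non-wrapping label are unchanged by the inclusion** (hypothesis `h1` with the
identity relabelling): if in every direction either the coordinate of `p` is `< m ≤ n - 1` or the
sizes agree. [folklore] -/
theorem bonds_castLE (h : ∀ i, n i ≤ n' i) {J : Finset (Fin d)} (hJ : ∀ i, i ∉ J → n i = n' i) {m : ℕ}
    (hm : ∀ i ∈ J, m + 1 ≤ n i) {p : BoxLabel n} (hp : ∀ j ∈ J, coord j p < m) :
    (castLE h p).bonds = p.bonds := by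
  have hdir : ∀ μ : Fin d, ((p.1 μ : ℕ) + 1 < n μ) ∨ n μ = n' μ := by
    intro μ
    by_cases hμ : μ ∈ J
    · left
      have := hp μ hμ
      have := hm μ hμ
      unfold coord at *
      omega
    · exact Or.inr (hJ μ hμ)
  simp only [bonds, castLE, ← BoxSite.castLE_shift h (hdir _), BoxSite.toEdge_castLE]

variable {G : Type*} [Group G] {N : ℕ} (ρ : G →* Matrix (Fin N) (Fin N) ℂ)

/-- **The cost of a non-wrapping label is unchanged by the inclusion** (hypothesis `h3` with the
identity relabelling). [folklore] -/
theorem cost_castLE (h : ∀ i, n i ≤ n' i) {J : Finset (Fin d)} (hJ : ∀ i, i ∉ J → n i = n' i) {m : ℕ}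
    (hm : ∀ i ∈ J, m + 1 ≤ n i) {p : BoxLabel n} (hp : ∀ j ∈ J, coord j p < m) (U : ZdGaugeConfig d G) :
    cost ρ (castLE h p) U = cost ρ p U := by
  have hdir : ∀ μ : Fin d, ((p.1 μ : ℕ) + 1 < n μ) ∨ n μ = n' μ := by
    intro μ
    by_cases hμ : μ ∈ J
    · left
      have := hp μ hμ
      have := hm μ hμ
      unfold coord at *
      omega
    · exact Or.inr (hJ μ hμ)
  simp only [cost, castLE, ← BoxSite.castLE_shift h (hdir _), BoxSite.toEdge_castLE]

end BoxLabel

/-! ### Rooted small clusters do not see the size of the box -/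

section Inclusion

variable {G : Type*} [Group G] {N : ℕ} {ρ : G →* Matrix (Fin N) (Fin N) ℂ}
  [TopologicalSpace G] [IsTopologicalGroup G] [CompactSpace G] [MeasurableSpace G] [BorelSpace G]

open scoped Classical in
/-- **Rooted small clusters and their truncated functionals agree across box sizes.** Let
`n ≤ n'` be sizes agreeing outside the set of directions `J` and with `m + 1 ≤ nᵢ` for `i ∈ J`. Then
the families of polymers of total size `< m` rooted in every direction of `J` are the same for the
boxes of sizes `n` and `n'` (along the inclusion `BoxLabel.castLE`, under which such families keep
their bonds, costs, activities, connectedness, cluster structure and `Φ^T` — the labels involved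
have coordinates `< m` in the directions of `J`, so none of their bonds wraps around a direction in
which the sizes differ), and the corresponding sums of truncated functionals coincide.
[cite: SeilerLNP1982, Ch. 2] -/
theorem sum_small_boxRooted_eq_of_le (hρ : Continuous ρ) (h : ∀ i, n i ≤ n' i) (J : Finset (Fin d))
    (hJ : ∀ i, i ∉ J → n i = n' i) {m : ℕ} (hm : ∀ i ∈ J, m + 1 ≤ n i) (hn : ∀ i, 0 < n i) (β : ℂ) :
    ∑ 𝒞 ∈ ((rconnSubsets (boxSystem (G := G) ρ n).Adj Finset.univ).powerset.filter
        fun 𝒞 => ∑ Y ∈ 𝒞, (Y.card : ℝ) < m) with ∀ j ∈ J, BoxRooted j m 𝒞,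
        truncatedWeight (GeomInc (boxSystem (G := G) ρ n).Adj)
          (connActivity (boxSystem (G := G) ρ n).Adj (zdHaar d G) ((boxSystem (G := G) ρ n).weight β)) 𝒞 =
      ∑ 𝒞 ∈ ((rconnSubsets (boxSystem (G := G) ρ n').Adj Finset.univ).powerset.filter
        fun 𝒞 => ∑ Y ∈ 𝒞, (Y.card : ℝ) < m) with ∀ j ∈ J, BoxRooted j m 𝒞,
        truncatedWeight (GeomInc (boxSystem (G := G) ρ n').Adj)
          (connActivity (boxSystem (G := G) ρ n').Adj (zdHaar d G) ((boxSystem (G := G) ρ n').weight β)) 𝒞 := by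
  set T := boxSystem (G := G) ρ n with hT
  set T' := boxSystem (G := G) ρ n' with hT'
  set Φ : Finset (Finset (BoxLabel n)) → ℂ := truncatedWeight (GeomInc T.Adj)
    (connActivity T.Adj (zdHaar d G) (T.weight β)) with hΦ
  set Φ' : Finset (Finset (BoxLabel n')) → ℂ := truncatedWeight (GeomInc T'.Adj)
    (connActivity T'.Adj (zdHaar d G) (T'.weight β)) with hΦ'
  set A : Finset (BoxLabel n) := Finset.univ.filter fun p => ∀ j ∈ J, BoxLabel.coord j p < m with hA
  set cast : BoxLabel n → BoxLabel n' := BoxLabel.castLE h with hcast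
  set castF : Finset (Finset (BoxLabel n)) → Finset (Finset (BoxLabel n')) :=
    fun 𝒞 => 𝒞.image (Finset.image cast) with hcastF
  have hR := boxSystem_regular (d := d) (G := G) ρ hρ n
  -- the hypotheses of the local isomorphism along `cast` on `A`, with the identity relabelling
  have h1 : ∀ p ∈ A, T'.bonds (cast p) = (T.bonds p).image id := by
    intro p hp
    rw [Finset.image_id]
    exact BoxLabel.bonds_castLE h hJ hm (Finset.mem_filter.1 hp).2
  have h2 : Set.InjOn (id : ZdEdge d → ZdEdge d) (↑(A.biUnion T.bonds) : Set (ZdEdge d)) := Set.injOn_id _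
  have h3 : ∀ p ∈ A, ∀ U : ZdGaugeConfig d G, T'.cost (cast p) U = T.cost p (U ∘ id) := by
    intro p hp U
    rw [Function.comp_id]
    exact BoxLabel.cost_castLE ρ h hJ hm (Finset.mem_filter.1 hp).2 U
  have h4 : Set.InjOn cast A := (BoxLabel.castLE_injective h).injOn
  -- families supported in `A`: transport of everything
  have hmemA : ∀ {𝒞 : Finset (Finset (BoxLabel n))}, (∀ j ∈ J, BoxRooted j m 𝒞) → ∀ Y ∈ 𝒞, Y ⊆ A :=
    fun hroot Y hY p hp => Finset.mem_filter.2 ⟨Finset.mem_univ _, fun j hj => (hroot j hj).1 Y hY p hp⟩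
  have hrootF : ∀ (𝒞 : Finset (Finset (BoxLabel n))) (j : Fin d), BoxRooted j m (castF 𝒞) ↔ BoxRooted j m 𝒞 := by
    intro 𝒞 j
    unfold BoxRooted
    constructor
    · rintro ⟨ha, Y', hY', p', hp', h0⟩
      obtain ⟨Y, hY, rfl⟩ := Finset.mem_image.1 hY'
      obtain ⟨p, hp, rfl⟩ := Finset.mem_image.1 hp'
      refine ⟨fun Y hY p hp => ?_, Y, hY, p, hp, h0⟩
      exact ha _ (Finset.mem_image_of_mem _ hY) _ (Finset.mem_image_of_mem _ hp)
    · rintro ⟨ha, Y, hY, p, hp, h0⟩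
      refine ⟨fun Y' hY' p' hp' => ?_, Y.image cast, Finset.mem_image_of_mem _ hY, cast p,
        Finset.mem_image_of_mem _ hp, h0⟩
      obtain ⟨Y, hY, rfl⟩ := Finset.mem_image.1 hY'
      obtain ⟨p, hp, rfl⟩ := Finset.mem_image.1 hp'
      exact ha Y hY p hp
  have hSmF : ∀ {𝒞 : Finset (Finset (BoxLabel n))}, (∀ Y ∈ 𝒞, Y ⊆ A) →
      (castF 𝒞 ∈ (rconnSubsets T'.Adj Finset.univ).powerset.filter
          (fun 𝒞 => ∑ Y ∈ 𝒞, (Y.card : ℝ) < m) ↔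
        𝒞 ∈ (rconnSubsets T.Adj Finset.univ).powerset.filter fun 𝒞 => ∑ Y ∈ 𝒞, (Y.card : ℝ) < m) := by
    intro 𝒞 h𝒞A
    simp only [Finset.mem_filter, Finset.mem_powerset, hcastF, PlaqSystem.sum_card_image_image h4 h𝒞A]
    refine and_congr_left fun _ => ⟨fun hs Y hY => ?_, fun hs Y' hY' => ?_⟩
    · have hY' := hs (Finset.mem_image_of_mem _ hY)
      rw [PlaqSystem.mem_rconnSubsets_image_iff h1 h2 h4 (h𝒞A Y hY) (Finset.subset_univ _)] at hY'
      exact mem_rconnSubsets.2 ⟨Finset.subset_univ _, hY'⟩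
    · obtain ⟨Y, hY, rfl⟩ := Finset.mem_image.1 hY'
      rw [PlaqSystem.mem_rconnSubsets_image_iff h1 h2 h4 (h𝒞A Y hY) (Finset.subset_univ _)]
      exact (mem_rconnSubsets.1 (hs hY)).2
  have hΦF : ∀ {𝒞 : Finset (Finset (BoxLabel n))}, (∀ Y ∈ 𝒞, Y ⊆ A) → Φ' (castF 𝒞) = Φ 𝒞 :=
    fun h𝒞A => PlaqSystem.truncatedWeight_image_image_eq hR h1 h2 h3 h4 h𝒞A β
  -- the right-hand index set is the image of the left-hand one
  set B := ((rconnSubsets T.Adj Finset.univ).powerset.filter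
      fun 𝒞 => ∑ Y ∈ 𝒞, (Y.card : ℝ) < m).filter fun 𝒞 => ∀ j ∈ J, BoxRooted j m 𝒞 with hB
  set B' := ((rconnSubsets T'.Adj Finset.univ).powerset.filter
      fun 𝒞 => ∑ Y ∈ 𝒞, (Y.card : ℝ) < m).filter fun 𝒞 => ∀ j ∈ J, BoxRooted j m 𝒞 with hB'
  -- the partial inverse on labels with all coordinates below `n`
  set down : BoxLabel n' → BoxLabel n := fun p' => (fun j => ⟨((p'.1 j : ℕ)) % n j, Nat.mod_lt _ (hn j)⟩, p'.2)
    with hdown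
  have hcast_down : ∀ p' : BoxLabel n', (∀ j, BoxLabel.coord j p' < n j) → cast (down p') = p' := by
    intro p' hp'
    refine Prod.ext (funext fun j => Fin.ext ?_) rfl
    simp only [hcast, BoxLabel.castLE, BoxSite.castLE, Fin.val_castLE, hdown]
    exact Nat.mod_eq_of_lt (hp' j)
  have himage : B' = B.image castF := by
    ext 𝒞'
    constructor
    · intro h𝒞'
      obtain ⟨h𝒞'S, hroot'⟩ := Finset.mem_filter.1 h𝒞'
      -- all coordinates of the labels of `𝒞'` are below `n`
      have hsmall' : ∀ Y' ∈ 𝒞', ∀ p' ∈ Y', ∀ j, BoxLabel.coord j p' < n j := by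
        intro Y' hY' p' hp' j
        by_cases hj : j ∈ J
        · exact lt_of_lt_of_le ((hroot' j hj).1 Y' hY' p' hp') (by have := hm j hj; omega)
        · rw [hJ j hj]; exact BoxLabel.coord_lt j p'
      set 𝒞 := 𝒞'.image (Finset.image down) with h𝒞
      have hcastF𝒞 : castF 𝒞 = 𝒞' := by
        simp only [hcastF, h𝒞, Finset.image_image]
        conv_rhs => rw [← Finset.image_id (s := 𝒞')]
        refine Finset.image_congr fun Y' hY' => ?_
        simp only [Function.comp_apply, Finset.image_image, id]
        conv_rhs => rw [← Finset.image_id (s := Y')]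
        exact Finset.image_congr fun p' hp' => by
          simpa using hcast_down p' (hsmall' Y' (Finset.mem_coe.1 hY') p' (Finset.mem_coe.1 hp'))
      have h𝒞A : ∀ Y ∈ 𝒞, Y ⊆ A := by
        intro Y hY p hp
        obtain ⟨Y', hY', rfl⟩ := Finset.mem_image.1 hY
        obtain ⟨p', hp', rfl⟩ := Finset.mem_image.1 hp
        refine Finset.mem_filter.2 ⟨Finset.mem_univ _, fun j hj => ?_⟩
        have hc : BoxLabel.coord j (down p') = BoxLabel.coord j p' := by
          simp only [BoxLabel.coord, hdown]
          exact Nat.mod_eq_of_lt (hsmall' Y' hY' p' hp' j)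
        rw [hc]
        exact (hroot' j hj).1 Y' hY' p' hp'
      refine Finset.mem_image.2 ⟨𝒞, Finset.mem_filter.2 ⟨?_, fun j hj => ?_⟩, hcastF𝒞⟩
      · exact (hSmF h𝒞A).1 (hcastF𝒞 ▸ h𝒞'S)
      · exact (hrootF 𝒞 j).1 (hcastF𝒞 ▸ hroot' j hj)
    · intro h𝒞'
      obtain ⟨𝒞, h𝒞B, rfl⟩ := Finset.mem_image.1 h𝒞'
      obtain ⟨h𝒞S, hroot⟩ := Finset.mem_filter.1 h𝒞B
      exact Finset.mem_filter.2 ⟨(hSmF (hmemA hroot)).2 h𝒞S, fun j hj => (hrootF 𝒞 j).2 (hroot j hj)⟩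
  have hinj : Set.InjOn castF (B : Set (Finset (Finset (BoxLabel n)))) :=
    (Finset.image_injective (Finset.image_injective (BoxLabel.castLE_injective h))).injOn
  rw [himage, Finset.sum_image hinj]
  exact Finset.sum_congr rfl fun 𝒞 h𝒞 => (hΦF (hmemA (Finset.mem_filter.1 h𝒞).2)).symm

end Inclusion

end Literature.MathematicalPhysics.QuantumFieldTheory
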